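import Summits.CriticalPhenomena.SAWScalingLimit.Theorems.SAWDevelopingMapNoFoldBoundInteriorCore

/-!
# `NoFoldBound`, line Ideator3Sketch — interior vertices IV: the pointwise interior core

Crux `NoFoldBound` (stmt-CriticalPhenomena-8296), route `SAWDevelopingMap`, lead seat c3.
`interior_core` / `interior_of_hyps` (file `…NoFoldBoundInteriorCore`) turn slit coherence with ONE
constant `k` at ALL interior vertices into the no-fold inequality at all interior vertices. The
reshaped skeleton v6 (`NoFoldBound_of : SourceLoopBound → InteriorFlattening → NoFoldBound`) splits the
interior by DEPTH — `R`-deep vertices are flattened by the sibling crux `InteriorFlattening`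
(stmt-CriticalPhenomena-8297), the collar (vertices within distance `R` of `Λᶜ`) is the residual stub —
so the glue needs the same two facts ONE VERTEX AT A TIME: `interior_core_at` (slit coherence at `v` in a
positive labelling, with constant `k`, gives the six labelled no-fold inequalities at `v` with `max k 0`)
and `interior_labellings_at` (slit coherence at `v` in every positive labelling gives the no-fold
inequality at `v` in every labelling). Proofs are those of the uniform versions, with the coherence
hypothesis taken at the vertex (port renewal `hPR`, slit simple connectivity `hSSC`, `interior_modes`,
DCS Lemma 1 at `v` for the anti-cyclic labellings, `six_labellings` bookkeeping). [folklore]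
-/

noncomputable section

open scoped BigOperators
open Literature.Probability.LatticeModels Literature.Probability.RandomPlanarGeometry.SAW

namespace Summit.CriticalPhenomena.SAWScalingLimit.Theorems.SAWDevelopingMapNoFoldBound

/-- **Interior core at one vertex (positive labelling).** At a vertex `v` off the source mid-edge
all of whose neighbours lie in `Λ`, for the labelling `(w₀, w₁, w₂)` in the positive order (turn
`w₀ → v → w₁ = +π/3`): port renewal (`hPR`), slit simple connectivity (`hSSC`) and the slit-coherence
inequality AT `v` with constant `k` (`HC`) give the six labelled no-fold inequalities at `v` with
`max k 0` (cyclic labellings: the coherence inequality up to a unit; anti-cyclic ones: vanishing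
Beltrami mode, DCS Lemma 1 at `v`). Pointwise form of `interior_core`. [folklore] -/
theorem interior_core_at
    (hPR : ∀ (Λ : Finset HexVertex) (a : Sym2 HexVertex) (v w₀ w₁ w₂ : HexVertex), v ∈ Λ → v ∉ a →
      hexGraph.Adj v w₀ → hexGraph.Adj v w₁ → hexGraph.Adj v w₂ → w₀ ≠ w₁ → w₁ ≠ w₂ → w₀ ≠ w₂ →
      ∀ (x σ : ℝ),
        hexParafermionicObservable Λ a x σ s(v, w₀) =
          (∑ γ : HexMidEdgeSAW Λ a s(v, w₀), if v ∉ γ.verts then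
              γ.weight x σ * hexParafermionicObservable (Λ \ γ.verts.toFinset) s(w₀, v) x σ s(v, w₀)
            else 0) +
          (∑ γ : HexMidEdgeSAW Λ a s(v, w₁), if v ∉ γ.verts then
              γ.weight x σ * hexParafermionicObservable (Λ \ γ.verts.toFinset) s(w₁, v) x σ s(v, w₀)
            else 0) +
          (∑ γ : HexMidEdgeSAW Λ a s(v, w₂), if v ∉ γ.verts then
              γ.weight x σ * hexParafermionicObservable (Λ \ γ.verts.toFinset) s(w₂, v) x σ s(v, w₀)
            else 0))
    (hSSC : ∀ (Λ : Finset HexVertex), hexDomainSimplyConnected Λ → ∀ a ∈ hexDomainBoundary Λ,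
      ∀ (z : Sym2 HexVertex) (γ : HexMidEdgeSAW Λ a z), hexDomainSimplyConnected (Λ \ γ.verts.toFinset))
    {Λ : Finset HexVertex} (hΛ : hexDomainSimplyConnected Λ) {a : Sym2 HexVertex}
    (ha : a ∈ hexDomainBoundary Λ) {v : HexVertex} (hv : v ∈ Λ) (hva : v ∉ a)
    {w₀ w₁ w₂ : HexVertex}
    (h₀ : hexGraph.Adj v w₀) (h₁ : hexGraph.Adj v w₁) (h₂ : hexGraph.Adj v w₂)
    (h₀₁ : w₀ ≠ w₁) (h₁₂ : w₁ ≠ w₂) (h₀₂ : w₀ ≠ w₂)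
    (hchir : winding [hexMidpoint s(w₀, v), hexCenter v, hexMidpoint s(v, w₁)] = Real.pi / 3)
    {k : ℝ}
    (HC : let x : ℝ := hexCriticalFugacity
      let α : ℝ := 1 + 2 * hexCriticalFugacity * Real.cos (5 * Real.pi / 24)
      let β : ℝ := 1 + 2 * hexCriticalFugacity * Real.cos (11 * Real.pi / 24)
      let ω : ℂ := Complex.exp (2 * Real.pi * Complex.I / 3)
      let Z : (w p q : HexVertex) → HexMidEdgeSAW Λ a s(v, w) → ℝ :=
        fun w p q (γ : HexMidEdgeSAW Λ a s(v, w)) =>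
        ∑ δ : HexMidEdgeSAW ((Λ \ γ.verts.toFinset).erase v) s(v, p) s(v, q), x ^ δ.length
      let B : (w p q : HexVertex) → ℂ := fun w p q =>
        ∑ γ : HexMidEdgeSAW Λ a s(v, w), if v ∉ γ.verts then
          γ.weight x (5 / 8) * ((β + Real.sqrt 3 * x * Z w p q γ : ℝ) : ℂ) else 0
      let S : (w p q : HexVertex) → ℂ := fun w p q =>
        ∑ γ : HexMidEdgeSAW Λ a s(v, w), if v ∉ γ.verts then
          γ.weight x (5 / 8) * ((α - Real.sqrt 3 * x * Z w p q γ : ℝ) : ℂ) else 0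
      ‖B w₀ w₁ w₂ + ω * B w₁ w₂ w₀ + ω ^ 2 * B w₂ w₀ w₁‖ ≤
        k * ‖S w₀ w₁ w₂ + S w₁ w₂ w₀ + S w₂ w₀ w₁‖) :
    let F : Sym2 HexVertex → ℂ := hexParafermionicObservable Λ a hexCriticalFugacity (5 / 8)
    let ω : ℂ := Complex.exp (2 * Real.pi * Complex.I / 3)
    let S : ℝ := ‖F s(v, w₀) + F s(v, w₁) + F s(v, w₂)‖
    ‖F s(v, w₀) + ω * F s(v, w₁) + ω ^ 2 * F s(v, w₂)‖ ≤ max k 0 * S ∧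
    ‖F s(v, w₀) + ω * F s(v, w₂) + ω ^ 2 * F s(v, w₁)‖ ≤ max k 0 * S ∧
    ‖F s(v, w₁) + ω * F s(v, w₀) + ω ^ 2 * F s(v, w₂)‖ ≤ max k 0 * S ∧
    ‖F s(v, w₁) + ω * F s(v, w₂) + ω ^ 2 * F s(v, w₀)‖ ≤ max k 0 * S ∧
    ‖F s(v, w₂) + ω * F s(v, w₀) + ω ^ 2 * F s(v, w₁)‖ ≤ max k 0 * S ∧
    ‖F s(v, w₂) + ω * F s(v, w₁) + ω ^ 2 * F s(v, w₀)‖ ≤ max k 0 * S := by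
  dsimp only at HC ⊢
  obtain ⟨eSum, eBelt, eDCS⟩ := interior_modes hPR hSSC hΛ ha hv hva h₀ h₁ h₂ h₀₁ h₁₂ h₀₂ hchir
  set ω : ℂ := Complex.exp (2 * Real.pi * Complex.I / 3) with hω
  have hω3 : ω ^ 3 = 1 := omega_pow_three
  have hω1 : ‖ω‖ = 1 := norm_omega
  set F0 := hexParafermionicObservable Λ a hexCriticalFugacity (5 / 8) s(v, w₀) with hF0
  set F1 := hexParafermionicObservable Λ a hexCriticalFugacity (5 / 8) s(v, w₁) with hF1
  set F2 := hexParafermionicObservable Λ a hexCriticalFugacity (5 / 8) s(v, w₂) with hF2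
  have hk0 : k ≤ max k 0 := le_max_left _ _
  have hS : 0 ≤ ‖F0 + F1 + F2‖ := norm_nonneg _
  have main : ‖F0 + ω * F1 + ω ^ 2 * F2‖ ≤ max k 0 * ‖F0 + F1 + F2‖ := by
    rw [eBelt, eSum] at *
    exact HC.trans (mul_le_mul_of_nonneg_right hk0 hS)
  have zero : (0 : ℝ) ≤ max k 0 * ‖F0 + F1 + F2‖ := mul_nonneg (le_max_right _ _) hS
  refine ⟨main, by rw [eDCS, norm_zero]; exact zero, ?_, ?_, ?_, ?_⟩
  · rw [show F1 + ω * F0 + ω ^ 2 * F2 = ω * (F0 + ω * F2 + ω ^ 2 * F1) by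
      linear_combination (-F1) * hω3, eDCS, mul_zero, norm_zero]
    exact zero
  · rw [show F1 + ω * F2 + ω ^ 2 * F0 = ω ^ 2 * (F0 + ω * F1 + ω ^ 2 * F2) by
      linear_combination (-F1 - ω * F2) * hω3, norm_mul, norm_pow, hω1, one_pow, one_mul]
    exact main
  · rw [show F2 + ω * F0 + ω ^ 2 * F1 = ω * (F0 + ω * F1 + ω ^ 2 * F2) by
      linear_combination (-F2) * hω3, norm_mul, hω1, one_mul]
    exact main
  · rw [show F2 + ω * F1 + ω ^ 2 * F0 = ω ^ 2 * (F0 + ω * F2 + ω ^ 2 * F1) by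
      linear_combination (-F2 - ω * F1) * hω3, eDCS, mul_zero, norm_zero]
    exact zero

/-- **The no-fold inequality at one interior vertex, every labelling, from slit coherence at that
vertex.** At a vertex `v` off the source mid-edge all of whose neighbours lie in `Λ`: port renewal,
slit simple connectivity and the slit-coherence inequality at `v` with constant `k` in EVERY positive
labelling (`HC`) give the no-fold inequality at `v` with `max k 0` in every labelling (positive
labellings: `interior_core_at`; a negative labelling is a positive one with `w₁, w₂` exchanged;
bookkeeping by `six_labellings`). Pointwise form of `interior_of_hyps`; this is what a depth
stratification of the interior consumes. [folklore] -/
theorem interior_labellings_at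
    (hPR : ∀ (Λ : Finset HexVertex) (a : Sym2 HexVertex) (v w₀ w₁ w₂ : HexVertex), v ∈ Λ → v ∉ a →
      hexGraph.Adj v w₀ → hexGraph.Adj v w₁ → hexGraph.Adj v w₂ → w₀ ≠ w₁ → w₁ ≠ w₂ → w₀ ≠ w₂ →
      ∀ (x σ : ℝ),
        hexParafermionicObservable Λ a x σ s(v, w₀) =
          (∑ γ : HexMidEdgeSAW Λ a s(v, w₀), if v ∉ γ.verts then
              γ.weight x σ * hexParafermionicObservable (Λ \ γ.verts.toFinset) s(w₀, v) x σ s(v, w₀)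
            else 0) +
          (∑ γ : HexMidEdgeSAW Λ a s(v, w₁), if v ∉ γ.verts then
              γ.weight x σ * hexParafermionicObservable (Λ \ γ.verts.toFinset) s(w₁, v) x σ s(v, w₀)
            else 0) +
          (∑ γ : HexMidEdgeSAW Λ a s(v, w₂), if v ∉ γ.verts then
              γ.weight x σ * hexParafermionicObservable (Λ \ γ.verts.toFinset) s(w₂, v) x σ s(v, w₀)
            else 0))
    (hSSC : ∀ (Λ : Finset HexVertex), hexDomainSimplyConnected Λ → ∀ a ∈ hexDomainBoundary Λ,
      ∀ (z : Sym2 HexVertex) (γ : HexMidEdgeSAW Λ a z),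
        hexDomainSimplyConnected (Λ \ γ.verts.toFinset))
    {Λ : Finset HexVertex} (hΛ : hexDomainSimplyConnected Λ) {a : Sym2 HexVertex}
    (ha : a ∈ hexDomainBoundary Λ) {v : HexVertex} (hv : v ∈ Λ) (hva : v ∉ a) {k : ℝ}
    (HC : ∀ w₀ w₁ w₂ : HexVertex, hexGraph.Adj v w₀ → hexGraph.Adj v w₁ → hexGraph.Adj v w₂ →
      w₀ ≠ w₁ → w₁ ≠ w₂ → w₀ ≠ w₂ →
      winding [hexMidpoint s(w₀, v), hexCenter v, hexMidpoint s(v, w₁)] = Real.pi / 3 →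
      let x : ℝ := hexCriticalFugacity
      let α : ℝ := 1 + 2 * hexCriticalFugacity * Real.cos (5 * Real.pi / 24)
      let β : ℝ := 1 + 2 * hexCriticalFugacity * Real.cos (11 * Real.pi / 24)
      let ω : ℂ := Complex.exp (2 * Real.pi * Complex.I / 3)
      let Z : (w p q : HexVertex) → HexMidEdgeSAW Λ a s(v, w) → ℝ :=
        fun w p q (γ : HexMidEdgeSAW Λ a s(v, w)) =>
        ∑ δ : HexMidEdgeSAW ((Λ \ γ.verts.toFinset).erase v) s(v, p) s(v, q), x ^ δ.length
      let B : (w p q : HexVertex) → ℂ := fun w p q =>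
        ∑ γ : HexMidEdgeSAW Λ a s(v, w), if v ∉ γ.verts then
          γ.weight x (5 / 8) * ((β + Real.sqrt 3 * x * Z w p q γ : ℝ) : ℂ) else 0
      let S : (w p q : HexVertex) → ℂ := fun w p q =>
        ∑ γ : HexMidEdgeSAW Λ a s(v, w), if v ∉ γ.verts then
          γ.weight x (5 / 8) * ((α - Real.sqrt 3 * x * Z w p q γ : ℝ) : ℂ) else 0
      ‖B w₀ w₁ w₂ + ω * B w₁ w₂ w₀ + ω ^ 2 * B w₂ w₀ w₁‖ ≤
        k * ‖S w₀ w₁ w₂ + S w₁ w₂ w₀ + S w₂ w₀ w₁‖)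
    {w₀ w₁ w₂ : HexVertex}
    (h₀ : hexGraph.Adj v w₀) (h₁ : hexGraph.Adj v w₁) (h₂ : hexGraph.Adj v w₂)
    (h₀₁ : w₀ ≠ w₁) (h₁₂ : w₁ ≠ w₂) (h₀₂ : w₀ ≠ w₂) :
    let F : Sym2 HexVertex → ℂ := hexParafermionicObservable Λ a hexCriticalFugacity (5 / 8)
    let ω : ℂ := Complex.exp (2 * Real.pi * Complex.I / 3)
    ‖F s(v, w₀) + ω * F s(v, w₁) + ω ^ 2 * F s(v, w₂)‖ ≤
      max k 0 * ‖F s(v, w₀) + F s(v, w₁) + F s(v, w₂)‖ := by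
  dsimp only
  obtain ⟨ε, hε, T01, -, -, -, -, T02⟩ := stub_localTurns v w₀ w₁ w₂ h₀ h₁ h₂ h₀₁ h₁₂ h₀₂
  rcases hε with rfl | rfl
  · have hchir : winding [hexMidpoint s(w₀, v), hexCenter v, hexMidpoint s(v, w₁)] = Real.pi / 3 := by
      rw [T01]; ring
    have h6 := interior_core_at hPR hSSC hΛ ha hv hva h₀ h₁ h₂ h₀₁ h₁₂ h₀₂ hchir
      (HC w₀ w₁ w₂ h₀ h₁ h₂ h₀₁ h₁₂ h₀₂ hchir)
    exact six_labellings (fun w => hexParafermionicObservable Λ a hexCriticalFugacity (5 / 8) s(v, w))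
      w₀ w₁ w₂ (max k 0) h6 (Or.inl rfl) (Or.inr (Or.inl rfl)) (Or.inr (Or.inr rfl)) h₀₁ h₁₂ h₀₂
  · have hchir : winding [hexMidpoint s(w₀, v), hexCenter v, hexMidpoint s(v, w₂)] = Real.pi / 3 := by
      rw [T02]; ring
    have h6 := interior_core_at hPR hSSC hΛ ha hv hva h₀ h₂ h₁ h₀₂ h₁₂.symm h₀₁ hchir
      (HC w₀ w₂ w₁ h₀ h₂ h₁ h₀₂ h₁₂.symm h₀₁ hchir)
    exact six_labellings (fun w => hexParafermionicObservable Λ a hexCriticalFugacity (5 / 8) s(v, w))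
      w₀ w₂ w₁ (max k 0) h6 (Or.inl rfl) (Or.inr (Or.inr rfl)) (Or.inr (Or.inl rfl)) h₀₁ h₁₂ h₀₂

end Summit.CriticalPhenomena.SAWScalingLimit.Theorems.SAWDevelopingMapNoFoldBound
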